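import Mathlib
import Summits.Ventures.DiscreteObjects.Mahler.CyclotomicFieldIntegersLehmer
import Summits.Ventures.DiscreteObjects.Mahler.SubLehmerStructure
import Summits.Ventures.DiscreteObjects.Mahler.NonreciprocalMeasureBound

/-!
# An irreducible sub-Lehmer polynomial has no root in any cyclotomic field (venture `DiscreteObjects`, target L)

Cell `pub-namedobj`, seat `pub-namedobj-mahler-g28`. Framing: lottery ticket; floor = certified bounds/negative ranges.

Census reading of Lehmer's conjecture for cyclotomic integers ([cite: BombieriGubler2001, Theorem 4.4.9], all conductors:
`CyclotomicIntegerLehmerAll`, `CyclotomicFieldIntegersLehmer`) in the cell vocabulary `SubLehmer P : 1 < M(P) < M(ℓ)`: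
**if `P ∈ ℤ[X]` is irreducible and sub-Lehmer, then for every `m ≥ 1` no complex root of `P` lies in the cyclotomic
field `ℚ(ζ_m) ⊂ ℂ`** (`subLehmer_irreducible_root_not_mem_cyclotomicField`) — the object target L looks for has a
non-abelian root field (Kronecker–Weber, informally).  Ingredients: roots of `P` are algebraic integers (`|lc P| = 1`
since `M(P) < 2`), they are `≠ 0` and not roots of unity (`SubLehmerStructure.core_coeff_zero_ne_zero`,
`core_not_cyclotomic_dvd`), and `CyclotomicFieldIntegersLehmer.subLehmer_root_mem_cyclotomicField_torsion`.
Bookkeeping; no new mathematics claimed.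
-/

namespace Summit.Ventures.DiscreteObjects.Mahler

open Polynomial

/-- A root of an irreducible sub-Lehmer polynomial is an algebraic integer (`|leading coefficient| = 1` as `M < 2`). -/
theorem isIntegral_root_of_subLehmer_irreducible {P : ℤ[X]} (hirr : Irreducible P) (hP : SubLehmer P) {α : ℂ}
    (hroot : aeval α P = 0) : IsIntegral ℤ α := by
  have h := abs_leadingCoeff_le_intMahlerMeasure P
  have hne : P.leadingCoeff ≠ 0 := leadingCoeff_ne_zero.mpr hirr.ne_zero
  have h1 : (1 : ℤ) ≤ |P.leadingCoeff| := Int.one_le_abs hne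
  have hL := lehmer_measure_upper_bound
  have h2 : (|P.leadingCoeff| : ℝ) < 2 := by linarith [hP.2]
  have h3 : |P.leadingCoeff| < 2 := by exact_mod_cast h2
  have hlc : |P.leadingCoeff| = 1 := le_antisymm (by omega) h1
  rcases (abs_eq (by norm_num : (0 : ℤ) ≤ 1)).1 hlc with hpos | hneg
  · exact ⟨P, hpos, by rw [← aeval_def]; exact hroot⟩
  · refine ⟨-P, by rw [Monic, leadingCoeff_neg, hneg, neg_neg], ?_⟩
    rw [eval₂_neg, ← aeval_def, hroot, neg_zero]

/-- **An irreducible sub-Lehmer polynomial has no root in any cyclotomic field** (census reading of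
[cite: BombieriGubler2001, Theorem 4.4.9]): if `P ∈ ℤ[X]` is irreducible with `1 < M(P) < M(ℓ)`, then for every
`m ≥ 1` and every primitive `m`-th root of unity `ζ ∈ ℂ`, no complex root of `P` lies in `ℚ(ζ)`.  (By Kronecker–Weber,
informally: the root field of a sub-Lehmer polynomial is not abelian over `ℚ`.) -/
theorem subLehmer_irreducible_root_not_mem_cyclotomicField {P : ℤ[X]} (hirr : Irreducible P) (hP : SubLehmer P)
    {m : ℕ} (hm : 0 < m) {ζ : ℂ} (hζ : IsPrimitiveRoot ζ m) {α : ℂ} (hroot : aeval α P = 0) :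
    α ∉ IntermediateField.adjoin ℚ {ζ} := by
  intro hα
  have hint := isIntegral_root_of_subLehmer_irreducible hirr hP hroot
  rcases subLehmer_root_mem_cyclotomicField_torsion hP hm hζ hα hint hroot with h0 | ⟨k, hk, hk1⟩
  · -- `α = 0`: then `P(0) = 0`, i.e. `x ∣ P`
    apply core_coeff_zero_ne_zero hirr hP
    have h := hroot
    rw [h0, aeval_def, eval₂_at_zero, algebraMap_int_eq, eq_intCast] at h
    exact_mod_cast h
  · -- `α` a root of unity of order `j`: then `Φ_j ∣ P`
    have hfin : IsOfFinOrder α := isOfFinOrder_iff_pow_eq_one.2 ⟨k, hk, hk1⟩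
    have hj : 0 < orderOf α := hfin.orderOf_pos
    have hprim : IsPrimitiveRoot α (orderOf α) := IsPrimitiveRoot.orderOf α
    apply core_not_cyclotomic_dvd hirr hP hj
    rw [cyclotomic_eq_minpoly hprim hj]
    exact minpoly.isIntegrallyClosed_dvd hint hroot

end Summit.Ventures.DiscreteObjects.Mahler
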